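import Mathlib.Data.ZMod.Basic
import Literature.Computability.Cryptography.WordRAMArithRoutines
import HarnessLib

/-!
# The word RAM — rounds of single-mode products and the final trilinear sum (Pratt, Thm. 1.9)

Machine part of the proof of `Literature.Computability.AlgebraicComplexity.pratt2024_thm_1_9`
(K. Pratt, STOC 2024, Thm. 1.9): the evaluation of the restricted trilinear form `T_k^{⊗r}` at the
three indicator vectors through an integral rank decomposition of a fixed power (§2: "this
evaluation can be done using `O((R̃(T_k)+ε/2)^r)` field operations"). The three vectors are
transformed by `j` rounds of single-mode products with the decomposition matrices (flat
little-endian layout, the `modeStep`/`modeIter` of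
`Literature/Computability/AlgebraicComplexity/PrattModeProducts.lean`), in NATIVE word arithmetic:
`mul`/`add` of the word RAM are multiplication/addition modulo `2^w`, so a cell is read as an
element of `ℤ/2^w` (`ZMod (2^w)`) and the computed transforms are those over `ℤ/2^w`.

This file, part I: the innermost loops.

* `zmodAcc` — the accumulated dot product in `ℤ/2^w`; `val_zmodAcc_succ` — one
  multiply–accumulate in words is one ring step in `ℤ/2^w`;
* `dotLoop` (registers `57 = acc`, `58` count, `59` strided read pointer, `60` matrix pointer,
  `67 =` stride, scratch `61`–`63`) and **`dotLoop_achieves`**: `acc := ∑_{s<Nm} M[row,s] · src[rd₀ + SG s]`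
  in `ℤ/2^w`, `8 Nm + 1` steps, memory untouched;
* `rowLoop` (registers `54` count, `55` matrix row pointer, `56` strided write pointer) and
  **`rowLoop_achieves`**: for `ℓ < R`, `dst[wr₀ + SG ℓ] := ∑_s M[ℓ,s] · src[rd₀ + SG s]`,
  `R (8 Nm + 10) + 1` steps, nothing outside the written cells changes.

## References

* [Pratt2024SCC] K. Pratt, STOC 2024, arXiv:2311.02774 — §2, proof of Thm. 1.9; §1.1.
* T. Nipkow, G. Klein, *Concrete Semantics with Isabelle/HOL*, Springer 2014, §12.
-/

namespace Literature.Computability.Cryptography.WordRAM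

/-! ## Word arithmetic is arithmetic in `ℤ/2^w` -/

/-- The accumulated dot product after `s` terms, in `ℤ/2^w`: `∑_{s'<s} M[mp + s'] · H[rd + SG s']`.
[cite: Pratt2024SCC, §2 (proof of Thm. 1.9)] -/
def zmodAcc (w : ℕ) (H : ℕ → ℕ) (mp rd SG : ℕ) : ℕ → ZMod (2 ^ w)
  | 0 => 0
  | s + 1 => zmodAcc w H mp rd SG s + (H (mp + s) : ZMod (2 ^ w)) * (H (rd + SG * s) : ZMod (2 ^ w))

/-- **One multiply–accumulate**: `(acc + (m · o mod 2^w)) mod 2^w` is the next partial dot product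
in `ℤ/2^w`, read back as a word. [folklore] -/
theorem val_zmodAcc_succ (w : ℕ) (H : ℕ → ℕ) (mp rd SG s : ℕ) :
    ((zmodAcc w H mp rd SG s).val + H (mp + s) * H (rd + SG * s) % 2 ^ w) % 2 ^ w =
      (zmodAcc w H mp rd SG (s + 1)).val := by
  rw [zmodAcc, ZMod.val_add, ← Nat.cast_mul, ZMod.val_natCast, Nat.add_mod, Nat.mod_mod, ← Nat.add_mod]

namespace SProg

variable {w : ℕ} {O : List ℕ → List ℕ}

/-! ## The dot-product loop -/

/-- The multiply–accumulate body: `m := mem[ms]; o := mem[rd]; t := m * o; acc := acc + t;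
rd := rd + SG; ms++; cnt--` (registers `57 = acc`, `58 = cnt`, `59 = rd`, `60 = ms`, `67 = SG`,
scratch `61, 62, 63`). [cite: Pratt2024SCC, §2 (proof of Thm. 1.9)] -/
def dotBody : List OpSpec :=
  [(.add, .dir 61, .ind 60, .imm 0), (.add, .dir 62, .ind 59, .imm 0), (.mul, .dir 63, .dir 61, .dir 62),
    (.add, .dir 57, .dir 57, .dir 63), (.add, .dir 59, .dir 59, .dir 67), (.add, .dir 60, .dir 60, .imm 1),
    (.sub, .dir 58, .dir 58, .imm 1)]

/-- The dot-product loop. [cite: Pratt2024SCC, §2 (proof of Thm. 1.9)] -/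
def dotLoop : SProg := whilenz (.dir 58) (block dotBody)

set_option linter.unusedSimpArgs false in
set_option maxHeartbeats 800000 in
/-- **Semantics of the dot-product loop**: from `acc = 0`, `cnt = Nm`, `rd = rd₀`, `ms = mp`
(all data cells words, addresses `mp + Nm`, `rd₀ + SG Nm` below `2^w`, data addresses), the loop
ends within `Nm (7 + 2) + 1` steps with `acc = (∑_{s<Nm} M[mp+s] · H[rd₀ + SG s] in ℤ/2^w).val`,
`cnt = 0`, memory untouched, registers outside `57`–`63` kept. [cite: Pratt2024SCC, §2 (proof of Thm. 1.9)] -/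
theorem dotLoop_achieves {R H : ℕ → ℕ} {Nm mp rd₀ SG : ℕ} (hmp : 100 ≤ mp) (hrd : 100 ≤ rd₀)
    (hmpw : mp + Nm < 2 ^ w) (hrdw : rd₀ + SG * Nm < 2 ^ w) (hH : ∀ a, H a < 2 ^ w)
    (h57 : R 57 = 0) (h58 : R 58 = Nm) (h59 : R 59 = rd₀) (h60 : R 60 = mp) (h67 : R 67 = SG) :
    Achieves w O dotLoop (merge R H)
      (fun m => ∃ R', m = merge R' H ∧ R' 57 = (zmodAcc w H mp rd₀ SG Nm).val ∧ R' 58 = 0 ∧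
        ∀ a, a < 57 ∨ 63 < a → R' a = R a)
      (Nm * (7 + 2) + 1) := by
  have hpos : 0 < 2 ^ w := Nat.two_pow_pos w
  let Inv : ℕ → (ℕ → ℕ) → Prop := fun s m => ∃ Sx, m = merge Sx H ∧ Sx 57 = (zmodAcc w H mp rd₀ SG s).val ∧
    Sx 58 = Nm - s ∧ Sx 59 = rd₀ + SG * s ∧ Sx 60 = mp + s ∧ Sx 67 = SG ∧ ∀ a, a < 57 ∨ 63 < a → Sx a = R a
  have hbody : ∀ s, s < Nm → ∀ m, Inv s m → (Operand.dir 58).read m ≠ 0 ∧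
      Achieves w O (block dotBody) m (Inv (s + 1)) 7 := by
    rintro s hs m ⟨Sx, rfl, h57', h58', h59', h60', h67', hSx⟩
    refine ⟨by rw [Operand.read_dir_merge (by omega), h58']; omega, Achieves.block ?_ le_rfl⟩
    have hSGs : SG * s + SG ≤ SG * Nm := by
      rw [← Nat.mul_succ]; exact Nat.mul_le_mul_left _ hs
    set mv := H (mp + s) with hmv
    set ov := H (rd₀ + SG * s) with hov
    have hmvw : mv < 2 ^ w := hH _
    have hovw : ov < 2 ^ w := hH _
    have haccw : (zmodAcc w H mp rd₀ SG s).val < 2 ^ w := ZMod.val_lt _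
    have e1 : BinOp.eval w .add mv 0 = mv := BinOp.eval_add_eq (Nat.add_zero _) hmvw
    have e2 : BinOp.eval w .add ov 0 = ov := BinOp.eval_add_eq (Nat.add_zero _) hovw
    have e3 : BinOp.eval w .mul mv ov = mv * ov % 2 ^ w := rfl
    have e4 : BinOp.eval w .add (zmodAcc w H mp rd₀ SG s).val (mv * ov % 2 ^ w) =
        (zmodAcc w H mp rd₀ SG (s + 1)).val := by
      rw [hmv, hov, ← val_zmodAcc_succ]; rfl
    have e5 : BinOp.eval w .add (rd₀ + SG * s) SG = rd₀ + SG * (s + 1) :=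
      BinOp.eval_add_eq (by rw [Nat.mul_succ, Nat.add_assoc]) (by rw [Nat.mul_succ]; omega)
    have e6 : BinOp.eval w .add (mp + s) 1 = mp + (s + 1) := BinOp.eval_add_eq (by omega) (by omega)
    have e7 : BinOp.eval w .sub (Nm - s) 1 = Nm - (s + 1) := BinOp.eval_sub_eq (by omega) (by omega) (by omega)
    refine ⟨Function.update (Function.update (Function.update (Function.update (Function.update
      (Function.update (Function.update Sx 61 mv) 62 ov) 63 (mv * ov % 2 ^ w)) 57
      (zmodAcc w H mp rd₀ SG (s + 1)).val) 59 (rd₀ + SG * (s + 1))) 60 (mp + (s + 1))) 58 (Nm - (s + 1)),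
      ?_, by simp, by simp, by simp, by simp, by simp [h67'], fun a ha => ?_⟩
    · unfold dotBody
      simp -failIfUnchanged (disch := omega) only [execOps_cons, execOps_nil, execOp, Operand.write,
        Operand.read, merge_apply_of_lt, merge_apply_of_le, Function.update_self,
        Function.update_of_ne, update_merge_of_lt, update_merge_of_le, h57', h58', h59', h60', h67',
        ne_eq, OfNat.ofNat_ne_zero, Nat.reduceEqDiff, ← hmv, ← hov, e1, e2, e3, e4, e5, e6, e7]
    · have : a ≠ 61 ∧ a ≠ 62 ∧ a ≠ 63 ∧ a ≠ 57 ∧ a ≠ 59 ∧ a ≠ 60 ∧ a ≠ 58 := by omega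
      simp [this, hSx a ha]
  have h0 : Inv 0 (merge R H) := ⟨R, rfl, by rw [h57, zmodAcc, ZMod.val_zero], by rw [h58, Nat.sub_zero],
    by rw [h59, Nat.mul_zero, Nat.add_zero], by rw [h60, Nat.add_zero], h67, fun a _ => rfl⟩
  exact Achieves.whilenz Nm 7 Inv hbody
    (fun m ⟨Sx, hm, _, h58', _⟩ => by rw [hm, Operand.read_dir_merge (by omega), h58', Nat.sub_self])
    h0 (fun m ⟨Sx, hm, h57', h58', _, _, _, hSx⟩ => ⟨Sx, hm, h57', by rw [h58', Nat.sub_self], hSx⟩) le_rfl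

/-! ## The row loop: all `R` rows at one position -/

/-- Before the dot product of row `ℓ`: `acc := 0; cnt := Nm; rd := rd₀; ms := mrow`
(registers `52 = rd₀`, `55 = mrow`). [folklore] -/
def rowPre (Nm : ℕ) : List OpSpec :=
  [(.add, .dir 57, .imm 0, .imm 0), (.add, .dir 58, .imm Nm, .imm 0), (.add, .dir 59, .dir 52, .imm 0),
    (.add, .dir 60, .dir 55, .imm 0)]

/-- After the dot product of row `ℓ`: `mem[wrp] := acc; wrp += SG; mrow += Nm; lcnt--`
(registers `56 = wrp`, `55 = mrow`, `54 = lcnt`, `67 = SG`). [folklore] -/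
def rowPost (Nm : ℕ) : List OpSpec :=
  [(.add, .ind 56, .dir 57, .imm 0), (.add, .dir 56, .dir 56, .dir 67), (.add, .dir 55, .dir 55, .imm Nm),
    (.sub, .dir 54, .dir 54, .imm 1)]

/-- The row loop: `while lcnt ≠ 0 { rowPre; dotLoop; rowPost }`. [cite: Pratt2024SCC, §2 (proof of Thm. 1.9)] -/
def rowLoop (Nm : ℕ) : SProg :=
  whilenz (.dir 54) (seq (block (rowPre Nm)) (seq dotLoop (block (rowPost Nm))))

/-- The value written for row `ℓ`: `(∑_{s<Nm} M[MB + ℓ Nm + s] · H[rd₀ + SG s]).val`.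
[cite: Pratt2024SCC, §2 (proof of Thm. 1.9)] -/
noncomputable def rowVal (w : ℕ) (H : ℕ → ℕ) (MB Nm rd₀ SG ℓ : ℕ) : ℕ :=
  (zmodAcc w H (MB + ℓ * Nm) rd₀ SG Nm).val

/-- The data after writing rows `< ℓ`: `rowVal ℓ'` at `wr₀ + SG ℓ'`. [folklore] -/
noncomputable def rowHeap (w : ℕ) (H : ℕ → ℕ) (MB Nm rd₀ SG wr₀ : ℕ) : ℕ → ℕ → ℕ
  | 0 => H
  | ℓ + 1 => Function.update (rowHeap w H MB Nm rd₀ SG wr₀ ℓ) (wr₀ + SG * ℓ) (rowVal w H MB Nm rd₀ SG ℓ)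

/-- Cells other than the written ones are unchanged. [folklore] -/
theorem rowHeap_apply_of_forall (w : ℕ) (H : ℕ → ℕ) (MB Nm rd₀ SG wr₀ : ℕ) {a : ℕ}
    (ha : ∀ ℓ', a ≠ wr₀ + SG * ℓ') : ∀ ℓ, rowHeap w H MB Nm rd₀ SG wr₀ ℓ a = H a
  | 0 => rfl
  | ℓ + 1 => by rw [rowHeap, Function.update_of_ne (ha ℓ), rowHeap_apply_of_forall w H MB Nm rd₀ SG wr₀ ha ℓ]

/-- Cells below the write base are unchanged. [folklore] -/
theorem rowHeap_apply_of_lt (w : ℕ) (H : ℕ → ℕ) (MB Nm rd₀ SG wr₀ : ℕ) {a : ℕ} (ha : a < wr₀) (ℓ : ℕ) :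
    rowHeap w H MB Nm rd₀ SG wr₀ ℓ a = H a :=
  rowHeap_apply_of_forall w H MB Nm rd₀ SG wr₀ (fun ℓ' h => by omega) ℓ

/-- The written cells (for a positive stride). [folklore] -/
theorem rowHeap_apply_written (w : ℕ) (H : ℕ → ℕ) (MB Nm rd₀ SG wr₀ : ℕ) (hSG : 0 < SG) :
    ∀ ℓ {ℓ' : ℕ}, ℓ' < ℓ → rowHeap w H MB Nm rd₀ SG wr₀ ℓ (wr₀ + SG * ℓ') = rowVal w H MB Nm rd₀ SG ℓ'
  | 0, _, h => absurd h (Nat.not_lt_zero _)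
  | ℓ + 1, ℓ', h => by
    rw [rowHeap]
    rcases Nat.lt_succ_iff_lt_or_eq.1 h with h' | rfl
    · rw [Function.update_of_ne, rowHeap_apply_written w H MB Nm rd₀ SG wr₀ hSG ℓ h']
      intro e
      have := Nat.eq_of_mul_eq_mul_left hSG (Nat.add_left_cancel e)
      omega
    · rw [Function.update_self]

/-- All cells stay words. [folklore] -/
theorem rowHeap_lt (w : ℕ) (H : ℕ → ℕ) (MB Nm rd₀ SG wr₀ : ℕ) (hH : ∀ a, H a < 2 ^ w) :
    ∀ ℓ a, rowHeap w H MB Nm rd₀ SG wr₀ ℓ a < 2 ^ w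
  | 0, a => hH a
  | ℓ + 1, a => by
    rw [rowHeap, Function.update_apply]
    split_ifs
    · haveI : NeZero (2 ^ w) := ⟨Nat.pos_iff_ne_zero.1 (Nat.two_pow_pos w)⟩
      exact ZMod.val_lt _
    · exact rowHeap_lt w H MB Nm rd₀ SG wr₀ hH ℓ a

set_option linter.unusedSimpArgs false in
set_option maxHeartbeats 1600000 in
/-- **Semantics of the row loop.** From `lcnt = R`, `mrow = MB` (the matrix, `R` rows of `Nm`
words, at `MB`), `wrp = wr₀`, with `rd₀` in `52` and the stride `SG > 0` in `67`; the matrix and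
the strided source `rd₀, rd₀ + SG, …` lie below the write base `wr₀` (so they are not overwritten);
everything is words and addresses do not wrap: the loop ends within `R ((4 + ((Nm (7+2) + 1) + 4)) + 2) + 1`
steps, the data is `rowHeap … R` (row `ℓ`'s dot product at `wr₀ + SG ℓ`), `wrp = wr₀ + SG R`,
`lcnt = 0`, registers outside `54`–`63` kept. [cite: Pratt2024SCC, §2 (proof of Thm. 1.9)] -/
theorem rowLoop_achieves {R H : ℕ → ℕ} {Rr Nm MB rd₀ SG wr₀ : ℕ} (hMB : 100 ≤ MB) (hrd : 100 ≤ rd₀)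
    (hwr : 100 ≤ wr₀) (hSG : 0 < SG) (hMBw : MB + Rr * Nm ≤ wr₀) (hrdw : rd₀ + SG * Nm ≤ wr₀)
    (hwrw : wr₀ + SG * Rr < 2 ^ w) (hNm : Nm < 2 ^ w) (hH : ∀ a, H a < 2 ^ w)
    (h52 : R 52 = rd₀) (h54 : R 54 = Rr) (h55 : R 55 = MB) (h56 : R 56 = wr₀) (h67 : R 67 = SG) :
    Achieves w O (rowLoop Nm) (merge R H)
      (fun m => ∃ R', m = merge R' (rowHeap w H MB Nm rd₀ SG wr₀ Rr) ∧ R' 56 = wr₀ + SG * Rr ∧ R' 54 = 0 ∧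
        ∀ a, a < 54 ∨ 63 < a → R' a = R a)
      (Rr * ((4 + ((Nm * (7 + 2) + 1) + 4)) + 2) + 1) := by
  let Inv : ℕ → (ℕ → ℕ) → Prop := fun ℓ m => ∃ Sx, m = merge Sx (rowHeap w H MB Nm rd₀ SG wr₀ ℓ) ∧
    Sx 52 = rd₀ ∧ Sx 54 = Rr - ℓ ∧ Sx 55 = MB + ℓ * Nm ∧ Sx 56 = wr₀ + SG * ℓ ∧ Sx 67 = SG ∧
    ∀ a, a < 54 ∨ 63 < a → Sx a = R a
  have hbody : ∀ ℓ, ℓ < Rr → ∀ m, Inv ℓ m → (Operand.dir 54).read m ≠ 0 ∧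
      Achieves w O (seq (block (rowPre Nm)) (seq dotLoop (block (rowPost Nm)))) m (Inv (ℓ + 1))
        (4 + ((Nm * (7 + 2) + 1) + 4)) := by
    rintro ℓ hℓ m ⟨Sx, rfl, hs52, hs54, hs55, hs56, hs67, hSx⟩
    refine ⟨by rw [Operand.read_dir_merge (by omega), hs54]; omega, ?_⟩
    set Hℓ := rowHeap w H MB Nm rd₀ SG wr₀ ℓ with hHℓ
    have hHℓw : ∀ a, Hℓ a < 2 ^ w := rowHeap_lt w H MB Nm rd₀ SG wr₀ hH ℓ
    have hℓNm : ℓ * Nm + Nm ≤ Rr * Nm := by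
      rw [← Nat.succ_mul]; exact Nat.mul_le_mul_right _ hℓ
    have hSGℓ : SG * ℓ + SG ≤ SG * Rr := by
      rw [← Nat.mul_succ]; exact Nat.mul_le_mul_left _ hℓ
    -- `rowPre`
    have e1 : BinOp.eval w .add 0 0 = 0 := BinOp.eval_add_eq rfl (by omega)
    have e2 : BinOp.eval w .add Nm 0 = Nm := BinOp.eval_add_eq (Nat.add_zero _) hNm
    have e3 : BinOp.eval w .add rd₀ 0 = rd₀ := BinOp.eval_add_eq (Nat.add_zero _) (by omega)
    have e4 : BinOp.eval w .add (MB + ℓ * Nm) 0 = MB + ℓ * Nm := BinOp.eval_add_eq (Nat.add_zero _) (by omega)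
    let S₁ := Function.update (Function.update (Function.update (Function.update Sx 57 0) 58 Nm) 59 rd₀) 60 (MB + ℓ * Nm)
    have hpre : Achieves w O (block (rowPre Nm)) (merge Sx Hℓ) (fun m => m = merge S₁ Hℓ) 4 := by
      refine Achieves.block ?_ le_rfl
      unfold rowPre
      simp -failIfUnchanged (disch := omega) only [execOps_cons, execOps_nil, execOp, Operand.write,
        Operand.read, merge_apply_of_lt, merge_apply_of_le, Function.update_self,
        Function.update_of_ne, update_merge_of_lt, update_merge_of_le, hs52, hs55, ne_eq,
        OfNat.ofNat_ne_zero, Nat.reduceEqDiff, e1, e2, e3, e4]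
      rfl
    -- the dot product, on the current data `Hℓ` (which agrees with `H` where it is read)
    have hdot := dotLoop_achieves (O := O) (R := S₁) (H := Hℓ) (Nm := Nm) (mp := MB + ℓ * Nm) (rd₀ := rd₀)
      (SG := SG) (by omega) hrd (by omega) (by omega) hHℓw (by simp [S₁]) (by simp [S₁]) (by simp [S₁])
      (by simp [S₁]) (by simp [S₁, hs67])
    have hval : (zmodAcc w Hℓ (MB + ℓ * Nm) rd₀ SG Nm).val = rowVal w H MB Nm rd₀ SG ℓ := by
      rw [rowVal]
      suffices h : ∀ s, s ≤ Nm → zmodAcc w Hℓ (MB + ℓ * Nm) rd₀ SG s = zmodAcc w H (MB + ℓ * Nm) rd₀ SG s by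
        rw [h Nm le_rfl]
      intro s hs
      induction s with
      | zero => rfl
      | succ s ih =>
        have hSGs : SG * s + SG ≤ SG * Nm := by rw [← Nat.mul_succ]; exact Nat.mul_le_mul_left _ hs
        rw [zmodAcc, zmodAcc, ih (by omega), hHℓ,
          rowHeap_apply_of_lt w H MB Nm rd₀ SG wr₀ (show MB + ℓ * Nm + s < wr₀ by omega),
          rowHeap_apply_of_lt w H MB Nm rd₀ SG wr₀ (show rd₀ + SG * s < wr₀ by omega)]
    -- `rowPost`
    have hpost : ∀ m, (∃ R', m = merge R' Hℓ ∧ R' 57 = (zmodAcc w Hℓ (MB + ℓ * Nm) rd₀ SG Nm).val ∧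
        R' 58 = 0 ∧ ∀ a, a < 57 ∨ 63 < a → R' a = S₁ a) →
        Achieves w O (block (rowPost Nm)) m (Inv (ℓ + 1)) 4 := by
      rintro m ⟨R', rfl, hr57, -, hR'⟩
      rw [hval] at hr57
      have hr56 : R' 56 = wr₀ + SG * ℓ := by rw [hR' 56 (by omega)]; simp [S₁, hs56]
      have hr55 : R' 55 = MB + ℓ * Nm := by rw [hR' 55 (by omega)]; simp [S₁, hs55]
      have hr54 : R' 54 = Rr - ℓ := by rw [hR' 54 (by omega)]; simp [S₁, hs54]
      have hr67 : R' 67 = SG := by rw [hR' 67 (by omega)]; simp [S₁, hs67]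
      have hrv : rowVal w H MB Nm rd₀ SG ℓ < 2 ^ w := by
        rw [rowVal]; haveI : NeZero (2 ^ w) := ⟨Nat.pos_iff_ne_zero.1 (Nat.two_pow_pos w)⟩; exact ZMod.val_lt _
      have e5 : BinOp.eval w .add (rowVal w H MB Nm rd₀ SG ℓ) 0 = rowVal w H MB Nm rd₀ SG ℓ :=
        BinOp.eval_add_eq (Nat.add_zero _) hrv
      have e6 : BinOp.eval w .add (wr₀ + SG * ℓ) SG = wr₀ + SG * (ℓ + 1) :=
        BinOp.eval_add_eq (by rw [Nat.mul_succ, Nat.add_assoc]) (by rw [Nat.mul_succ]; omega)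
      have e7 : BinOp.eval w .add (MB + ℓ * Nm) Nm = MB + (ℓ + 1) * Nm :=
        BinOp.eval_add_eq (by rw [Nat.succ_mul, Nat.add_assoc]) (by rw [Nat.succ_mul]; omega)
      have hRrw : Rr < 2 ^ w := lt_of_le_of_lt (Nat.le_mul_of_pos_left Rr hSG) (by omega)
      have e8 : BinOp.eval w .sub (Rr - ℓ) 1 = Rr - (ℓ + 1) := BinOp.eval_sub_eq (by omega) (by omega) (by omega)
      refine Achieves.block ⟨Function.update (Function.update (Function.update R' 56 (wr₀ + SG * (ℓ + 1))) 55
        (MB + (ℓ + 1) * Nm)) 54 (Rr - (ℓ + 1)), ?_, ?_, by simp, by simp, by simp, ?_, fun a ha => ?_⟩ le_rfl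
      · unfold rowPost
        simp -failIfUnchanged (disch := omega) only [execOps_cons, execOps_nil, execOp, Operand.write,
          Operand.read, merge_apply_of_lt, merge_apply_of_le, Function.update_self,
          Function.update_of_ne, update_merge_of_lt, update_merge_of_le, hr54, hr55, hr56, hr57, hr67,
          ne_eq, OfNat.ofNat_ne_zero, Nat.reduceEqDiff, e5, e6, e7, e8]
        rfl
      · simp [hR' 52 (by omega), S₁, hs52]
      · simp [hR' 67 (by omega), S₁, hs67]
      · have h1 : a ≠ 56 ∧ a ≠ 55 ∧ a ≠ 54 := by omega
        rw [Function.update_of_ne h1.2.2, Function.update_of_ne h1.2.1, Function.update_of_ne h1.1,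
          hR' a (by omega)]
        have h2 : a ≠ 57 ∧ a ≠ 58 ∧ a ≠ 59 ∧ a ≠ 60 := by omega
        simp [S₁, h2, hSx a ha]
    refine Achieves.seq hpre fun m hm => ?_
    rw [hm]
    exact Achieves.seq hdot hpost
  have h0 : Inv 0 (merge R H) := ⟨R, rfl, h52, by rw [h54, Nat.sub_zero], by rw [h55, Nat.zero_mul, Nat.add_zero],
    by rw [h56, Nat.mul_zero, Nat.add_zero], h67, fun a _ => rfl⟩
  exact Achieves.whilenz Rr _ Inv hbody
    (fun m ⟨Sx, hm, _, hs54, _⟩ => by rw [hm, Operand.read_dir_merge (by omega), hs54, Nat.sub_self])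
    h0 (fun m ⟨Sx, hm, _, hs54, _, hs56, _, hSx⟩ => ⟨Sx, hm, hs56, by rw [hs54, Nat.sub_self], hSx⟩) le_rfl

end SProg

end Literature.Computability.Cryptography.WordRAM
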